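import Mathlib.Analysis.SpecialFunctions.Trigonometric.Deriv
import Mathlib.Analysis.SpecialFunctions.Sqrt
import Mathlib.Analysis.Calculus.ContDiff.Basic
import Mathlib.Probability.Moments.Covariance
import Literature.MathematicalPhysics.KineticTheory.InfiniteChainDynamics
import HarnessLib

/-!
# The pinned harmonic host on `ℤ` carrying finitely many anharmonic cells

Topic `Literature/MathematicalPhysics/KineticTheory`; definition request `defn-HarmonicHostWithCell`
(for `stmt-AtomisticToContinuum-5550` SingleCellMixing and `stmt-AtomisticToContinuum-5129`
GaussianisationCLT of route `GaussianiserCellTransfer`).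

## The model

Lanford–Lebowitz–Lieb 1977 (§2, eqs. (1a)–(1c)) treat the lattice `ℤ^ν` with a **site-dependent**
self-energy `U_i(q_i)` and finite-range interaction energies `V_j(q)`:
`dq_i/dt = p_i`, `dp_i/dt = F_i = -∂U_i/∂q_i + R_i(q)`, `R_i = -∑_j ∂V_j/∂q_i`. The tree file
`InfiniteChainDynamics.lean` vendored the *homogeneous* nearest-neighbour chain (`U_i = U`,
`V_j(q) = V(q_{j+1} - q_j)`, data `P : OscillatorChain`). This file adds the site-dependent
nearest-neighbour case, `V_j(q) = V_j(q_{j+1} - q_j)` (data `P : InfiniteChain`, `P.U i`, `P.V i`),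
which is LLL's own generality restricted to pair interactions of range `1`, and the model the
requesting route needs:

* the **harmonic host with cells** `harmonicHostWithCell ω₂ lam β S`: pinning `ω₂ q²/2` and unit
  harmonic bonds `r²/2` everywhere, plus, at the prescribed sites `x ∈ S` (`S : Finset ℤ`), the
  conjunct cell `lam q_x⁴/4` (on site) and the FPU-`β` term `β (q_{x+1} - q_x)⁴/4` (on the bond
  `(x, x+1)`); `S = {0}` (one cell) and `S = {0, d}` (two cells at distance `d`) are the cases used.
  It is the instance `lam_i = lam·1_S(i)`, `β_i = β·1_S(i)` of the quartic profile chain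
  `quarticChain ω₂ lam β` (`lam β : ℤ → ℝ`), which also hosts the periodic dilute chain
  (`lam_i = lam·1_{d ∣ i}`) and the homogeneous `pinnedChain` (constant profiles,
  `OscillatorChain.toInfiniteChain_pinnedChain`).

## Contents

* `InfiniteChain` (data `U V : ℤ → ℝ → ℝ`), `force`, `siteEnergy` (LLL's `ℒ_i`), `IsSolution`,
  `IsSolutionOn`, `IsSeveredSolution` (LLL (9a)–(9c)), `expTempered` (LLL's `B_r`, eq. (4)),
  `CondB1`, `CondB2`; the Gibbsian objects `potential`, `specification T` (LLL (14) via
  `Literature.Probability.LatticeModels.gibbsSpecOfPotential`, interaction family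
  `OscillatorChain.chainSupp` reused), `IsGibbs`; the hypothesis structure `InfiniteChain.Dynamics`
  (flow on an invariant carrier, solving (1a)–(1b), unique within the carrier) with `flow_add`
  (proved) and `PreservesMeasure`.
* **Bridge to the homogeneous layer** (generalised, not duplicated): `OscillatorChain.toInfiniteChain`
  with `rfl`-level agreement of `force`, `siteEnergy`, `IsSolution`, `IsSolutionOn`,
  `IsSeveredSolution`, `expTempered`, `potential = chainPotential`,
  `specification = chainSpecification`, `IsGibbs ↔ IsChainGibbsMeasure`, `CondB1`, `CondB2`, and the
  equivalence `InfiniteChainDynamics P ≃ P.toInfiniteChain.Dynamics`. The ten homogeneous files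
  (`InfiniteChainDynamics*.lean`, `InfiniteChainSevered*.lean`, …, ≈ 3 900 lines of proofs keyed to
  `OscillatorChain`) are therefore instances of this layer and were not rewritten.
* `quarticChain`, `cellProfile`, `harmonicHostWithCell`, the explicit force (`quarticChain_force`),
  smoothness and lower bounds of the potentials, the host's dispersion relation
  `hostDispersion ω₂ k = √(ω₂ + 2 - 2 cos k)` with the phonon band `[√ω₂, √(ω₂ + 4)]`
  (`sqrt_le_hostDispersion`, `hostDispersion_le_sqrt`), and NON-VACUITY of `IsSolution`: the plane
  waves `A cos(k i - ω t + φ)` solve the pure host when `ω² = ω₂ + 2 - 2 cos k`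
  (`isSolution_planeWave`), and `0` is an equilibrium of every quartic profile chain.
* Observables and time correlations: `IsSmoothLocalObservable Λ F` (`F = f ∘ (σ ↦ σ|_Λ)` with
  `f ∈ C^∞((ℝ × ℝ)^Λ)` of polynomial growth) with its algebra (`const`, coordinates, `add`, `mul`,
  measurability); `Dynamics.timeCorrelation D μ F G t = ⟨F ; G ∘ Φ_t⟩_μ` (truncated correlation,
  Mathlib `ProbabilityTheory.covariance`); `Dynamics.HasCorrelationDecay` (`→ 0` as `t → ∞`) and
  `Dynamics.HasIntegrableCorrelationDecay` (`∫_0^∞ |⟨F ; G ∘ Φ_t⟩| dt < ∞`) for all smooth local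
  observables in a window `Λ` ("near the cell" = the statement's choice of `Λ ∋` the cell sites).

## What is NOT vendored, and why

* **Existence / uniqueness theorems for the inhomogeneous chain.** LLL's Thm 1 (strong existence,
  proved in tree for the homogeneous chain as `LanfordLebowitzLieb1977_thm1_chain_holds`) needs A4,
  `|p_i R_i| ≤ ∑ A_ij ℒ_j`, which FAILS at a site next to an FPU-`β` bond whose own pinning is
  harmonic (`p_{x+1} β (q_{x+1} - q_x)³` is not bounded by `p² + ω₂ q²`); LLL's Thm 3 (a.e.
  existence w.r.t. a Gibbs state, proved in tree for the homogeneous chain) is printed for general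
  interactions under A1, A2, B1, B2 and covers `harmonicHostWithCell`, but its ≈ 1 500-line
  homogeneous proof has not been generalised here; no statement-only fact is minted (D-0026).
  Statements needing a dynamics take `D : P.Dynamics` as data, exactly as with
  `InfiniteChainDynamics`.
* **The cell's generalized Langevin representation** (Ford–Kac–Mazur / Rubin elimination of the
  harmonic half-lines, memory kernel = half-chain response, noise covariance `T·K`): optional in the
  request; for `β ≠ 0` the bond `(x, x+1)` is anharmonic, so the reduced system is the pair
  `(q_x, q_{x+1})` coupled to the half-lines `(-∞, x-1]` and `[x+2, ∞)`, and the lattice kernel is a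
  separate computation not printed in the cited sources in this form. Not vendored.
* Measurability of `flow t` is not a field of `Dynamics` (as in `InfiniteChainDynamics`);
  `PreservesMeasure` asks for it through Mathlib `MeasurePreserving`.

## Junk values

`timeCorrelation` is a Bochner integral (junk `0` for non-integrable integrands) and `flow t` is
unconstrained off the carrier; `HasIntegrableCorrelationDecay` uses Mathlib `IntegrableOn` on
`(0, ∞)` (measurability in `t` included). Statements should assume `PreservesMeasure` (carrier of
full measure) and square-integrability where they want `⟨F ; G ∘ Φ_t⟩ = ∫ F (G ∘ Φ_t) - ∫F ∫G`
(`timeCorrelation_eq_integral_mul_sub`).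
-/

noncomputable section

open MeasureTheory ProbabilityTheory Filter Topology Set Literature.Probability.LatticeModels
open scoped ContDiff

namespace Literature.MathematicalPhysics.KineticTheory.HeatConduction

/-! ## Site-dependent nearest-neighbour chains on `ℤ` (LLL 1977 §2) -/

/-- Data of a nearest-neighbour oscillator chain on `ℤ` with **site-dependent** potentials: the
self-energy `U_i(q_i)` of site `i` and the interaction energy `V_i(q_{i+1} - q_i)` of the bond
`(i, i+1)` (Lanford–Lebowitz–Lieb 1977, §2, eqs. (1a)–(1c): `U_i`, `V_j` indexed by the lattice;
here `ν = 1`, range `D = 1`, pair interactions of the difference). [cite: LanfordLebowitzLieb1977, §2 eqs. (1a)–(1c)] -/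
@[ext] structure InfiniteChain where
  /-- the on-site (self-energy) potential `U_i` of site `i` -/
  U : ℤ → ℝ → ℝ
  /-- the interaction potential `V_i` of the bond `(i, i+1)`, a function of `q_{i+1} - q_i` -/
  V : ℤ → ℝ → ℝ

namespace InfiniteChain

variable (P : InfiniteChain)

/-- The interaction force on particle `i`:
`R_i(q) = -∑_j ∂V_j/∂q_i = V_i'(q_{i+1} - q_i) - V_{i-1}'(q_i - q_{i-1})` (LLL 1977, eq. (1c)). [cite: LanfordLebowitzLieb1977, §2 eq. (1c)] -/
def interactionForce (σ : ChainConfig) (i : ℤ) : ℝ :=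
  deriv (P.V i) ((σ (i + 1)).1 - (σ i).1) - deriv (P.V (i - 1)) ((σ i).1 - (σ (i - 1)).1)

/-- The total force `F_i = -U_i'(q_i) + R_i(q)` (LLL 1977, eq. (1b)). [cite: LanfordLebowitzLieb1977, §2 eq. (1b)] -/
def force (σ : ChainConfig) (i : ℤ) : ℝ :=
  -deriv (P.U i) (σ i).1 + P.interactionForce σ i

/-- LLL's local Lyapunov function `ℒ_i = ½ p_i² + U_i(q_i) + K` (LLL 1977, eq. (2b)). [cite: LanfordLebowitzLieb1977, §2 eq. (2b)] -/
def siteEnergy (K : ℝ) (σ : ChainConfig) (i : ℤ) : ℝ :=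
  (σ i).2 ^ 2 / 2 + P.U i (σ i).1 + K

/-- `γ : ℝ → ChainConfig` solves (1a)–(1b) for all times: `dq_i/dt = p_i`, `dp_i/dt = F_i(q(t))`
for every `i ∈ ℤ`, `t ∈ ℝ`. [cite: LanfordLebowitzLieb1977, §2 eqs. (1a)–(1b)] -/
def IsSolution (γ : ℝ → ChainConfig) : Prop :=
  ∀ (i : ℤ) (t : ℝ), HasDerivAt (fun s => (γ s i).1) (γ t i).2 t ∧
    HasDerivAt (fun s => (γ s i).2) (P.force (γ t) i) t

/-- `γ` solves (1a)–(1b) on the time set `I` (one-sided derivatives at endpoints). [cite: LanfordLebowitzLieb1977, §2 eqs. (1a)–(1b) and §3] -/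
def IsSolutionOn (γ : ℝ → ChainConfig) (I : Set ℝ) : Prop :=
  ∀ (i : ℤ), ∀ t ∈ I, HasDerivWithinAt (fun s => (γ s i).1) (γ t i).2 I t ∧
    HasDerivWithinAt (fun s => (γ s i).2) (P.force (γ t) i) I t

/-- The severed dynamics in the finite region `Λ` (LLL 1977, (9a)–(9c)): particles in `Λ` move under
the full force, particles outside `Λ` are tied down. [cite: LanfordLebowitzLieb1977, §2 eqs. (9a)–(9c)] -/
def IsSeveredSolution (Λ : Finset ℤ) (γ : ℝ → ChainConfig) : Prop :=
  (∀ i ∈ Λ, ∀ t : ℝ, HasDerivAt (fun s => (γ s i).1) (γ t i).2 t ∧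
    HasDerivAt (fun s => (γ s i).2) (P.force (γ t) i) t) ∧
  ∀ i ∉ Λ, ∀ t : ℝ, γ t i = γ 0 i

/-- LLL's admissible initial data `ℒ(0) ∈ B_r`: `sup_j e^{-r|j|} ℒ_j < ∞` (LLL 1977, eq. (4) and
Thm 1). [cite: LanfordLebowitzLieb1977, §2 eq. (4)] -/
def expTempered (r : ℝ) : Set ChainConfig :=
  {σ | ∃ C : ℝ, ∀ j : ℤ, P.siteEnergy 0 σ j ≤ C * Real.exp (r * |(j : ℝ)|)}

/-! ### Gibbs states (LLL 1977 §4, DLR) -/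

/-- The interaction potential of the chain (Georgii's sense): `Φ_{{x}} = ½ p_x² + U_x(q_x)`,
`Φ_{{x,x+1}} = V_x(q_{x+1} - q_x)`, `Φ_A = 0` otherwise (LLL 1977, Hamiltonian (10) with
site-dependent `U_i`, `V_j`; Georgii 2011, Def. 2.7). [cite: LanfordLebowitzLieb1977, §2 eq. (10) and §4] -/
def potential : Potential ℤ (ℝ × ℝ) := fun A σ =>
  (∑ x ∈ A, if A = {x} then (σ x).2 ^ 2 / 2 + P.U x (σ x).1 else 0) +
    ∑ x ∈ A, if A = {x, x + 1} then P.V x ((σ (x + 1)).1 - (σ x).1) else 0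

/-- The finite-volume Gibbs distributions at temperature `T`:
`Z_Λ(η)⁻¹ exp[-H_Λ(q,p)/T] ∏_{j∈Λ} dq_j dp_j`, configuration frozen to `η` off `Λ`, `H_Λ` the sum of
the site terms in `Λ` and the bond terms meeting `Λ` (LLL 1977, §4 eq. (14), `β = T⁻¹`; interaction
family `OscillatorChain.chainSupp`, a priori measure Lebesgue on `ℝ × ℝ`). [cite: LanfordLebowitzLieb1977, §4 eq. (14)] -/
def specification (T : ℝ) : Specification ℤ (ℝ × ℝ) :=
  gibbsSpecOfPotential (volume : Measure (ℝ × ℝ)) P.potential OscillatorChain.chainSupp T⁻¹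

/-- `μ` is a (DLR) Gibbs state of the chain at temperature `T` (LLL 1977, §4; Georgii 2011,
Def. 1.23). [cite: LanfordLebowitzLieb1977, §4] -/
def IsGibbs (T : ℝ) (μ : Measure ChainConfig) : Prop :=
  IsGibbsMeasure (P.specification T) μ

/-- LLL's condition **B1**: the severed equations (9a)–(9c) have global solutions for every
finite `Λ` and every initial point. [cite: LanfordLebowitzLieb1977, §4 condition B1] -/
def CondB1 (P : InfiniteChain) : Prop :=
  ∀ (Λ : Finset ℤ) (σ : ChainConfig), ∃ γ : ℝ → ChainConfig, γ 0 = σ ∧ P.IsSeveredSolution Λ γ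

/-- LLL's condition **B2**: every finite-volume Gibbs distribution (14) is normalisable. [cite: LanfordLebowitzLieb1977, §4 condition B2] -/
def CondB2 (T : ℝ) : Prop :=
  ∀ (Λ : Finset ℤ) (η : ChainConfig), IsProbabilityMeasure (P.specification T Λ η)

/-! ### API -/

/-- The force in terms of `U_i'`, `V_i'`, `V_{i-1}'`. [folklore] -/
theorem force_eq (σ : ChainConfig) (i : ℤ) :
    P.force σ i = -deriv (P.U i) (σ i).1 + deriv (P.V i) ((σ (i + 1)).1 - (σ i).1) -
      deriv (P.V (i - 1)) ((σ i).1 - (σ (i - 1)).1) := by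
  simp only [force, interactionForce]; ring

/-- A Gibbs state is a probability measure. [folklore] -/
theorem IsGibbs.isProbabilityMeasure {P : InfiniteChain} {T : ℝ} {μ : Measure ChainConfig}
    (h : P.IsGibbs T μ) : IsProbabilityMeasure μ :=
  h.1

/-- The on-site term of the potential. [folklore] -/
@[simp] theorem potential_singleton (σ : ChainConfig) (x : ℤ) :
    P.potential {x} σ = (σ x).2 ^ 2 / 2 + P.U x (σ x).1 := by
  have hne : ({x} : Finset ℤ) ≠ {x, x + 1} := by
    intro h
    have hx : x + 1 ∈ ({x, x + 1} : Finset ℤ) := by simp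
    rw [← h, Finset.mem_singleton] at hx
    omega
  simp [potential, hne]

/-- The bond term of the potential. [folklore] -/
@[simp] theorem potential_pair (σ : ChainConfig) (x : ℤ) :
    P.potential {x, x + 1} σ = P.V x ((σ (x + 1)).1 - (σ x).1) := by
  have hx : x ≠ x + 1 := by omega
  have h1 : ({x, x + 1} : Finset ℤ) ≠ {x} := by
    intro h
    have : x + 1 ∈ ({x} : Finset ℤ) := h ▸ (by simp)
    rw [Finset.mem_singleton] at this; omega
  have h2 : ({x, x + 1} : Finset ℤ) ≠ {x + 1} := by
    intro h
    have : x ∈ ({x + 1} : Finset ℤ) := h ▸ (by simp)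
    rw [Finset.mem_singleton] at this; omega
  have h3 : ({x, x + 1} : Finset ℤ) ≠ {x + 1, x + 1 + 1} := by
    intro h
    have : x ∈ ({x + 1, x + 1 + 1} : Finset ℤ) := h ▸ (by simp)
    simp only [Finset.mem_insert, Finset.mem_singleton] at this; omega
  simp [potential, Finset.sum_pair hx, h1, h2, h3]

/-- The potential vanishes on the empty set. [folklore] -/
@[simp] theorem potential_empty (σ : ChainConfig) : P.potential ∅ σ = 0 := by
  simp [potential]

/-- Time-shifts of solutions are solutions (autonomous system). [folklore] -/
theorem IsSolution.comp_add_const {P : InfiniteChain} {γ : ℝ → ChainConfig} (hγ : P.IsSolution γ)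
    (s : ℝ) : P.IsSolution fun t => γ (t + s) := by
  intro i t
  obtain ⟨h1, h2⟩ := hγ i (t + s)
  exact ⟨HasDerivAt.comp_add_const t s h1, HasDerivAt.comp_add_const t s h2⟩

/-- A constant configuration with vanishing forces is an equilibrium solution. [folklore] -/
theorem isSolution_const {P : InfiniteChain} {σ : ChainConfig} (hp : ∀ i, (σ i).2 = 0)
    (hF : ∀ i, P.force σ i = 0) : P.IsSolution fun _ => σ := by
  intro i t
  refine ⟨?_, ?_⟩
  · rw [hp i]; exact hasDerivAt_const t _
  · rw [hF i]; exact hasDerivAt_const t _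

/-! ### Infinite-volume dynamics as a hypothesis structure -/

/-- An **infinite-volume dynamics** of the chain `P`: an invariant set `carrier` of admissible
configurations and a flow `flow : ℝ → ChainConfig → ChainConfig` on it whose orbits solve
(1a)–(1b), with `flow 0 = id` on the carrier and uniqueness of solutions staying in the carrier
(LLL 1977, Thms 1–2; the homogeneous special case is `InfiniteChainDynamics`, see
`InfiniteChainDynamics.equivDynamics`). Off the carrier `flow t` is unconstrained. [cite: LanfordLebowitzLieb1977, §2 Thm 1 and §3 Thm 2] -/
structure Dynamics (P : InfiniteChain) where
  /-- the invariant set of admissible initial data -/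
  carrier : Set ChainConfig
  /-- the flow `Φ_t` -/
  flow : ℝ → ChainConfig → ChainConfig
  /-- `Φ_t` maps the carrier into itself -/
  mapsTo : ∀ t, MapsTo (flow t) carrier carrier
  /-- `Φ_0 = id` on the carrier -/
  flow_zero : ∀ σ ∈ carrier, flow 0 σ = σ
  /-- orbits are solutions of the equations of motion -/
  isSolution : ∀ σ ∈ carrier, P.IsSolution fun t => flow t σ
  /-- uniqueness: every solution staying in the carrier is an orbit of the flow -/
  unique : ∀ γ : ℝ → ChainConfig, (∀ t, γ t ∈ carrier) → P.IsSolution γ →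
    ∀ t, γ t = flow t (γ 0)

namespace Dynamics

variable {P} (D : P.Dynamics)

/-- Orbits stay in the carrier. [folklore] -/
theorem flow_mem {σ : ChainConfig} (hσ : σ ∈ D.carrier) (t : ℝ) : D.flow t σ ∈ D.carrier :=
  D.mapsTo t hσ

/-- **Group law** `Φ_{t+s} = Φ_t ∘ Φ_s` on the carrier, from uniqueness. [folklore] -/
theorem flow_add {σ : ChainConfig} (hσ : σ ∈ D.carrier) (t s : ℝ) :
    D.flow (t + s) σ = D.flow t (D.flow s σ) := by
  have h := D.unique (fun u => D.flow (u + s) σ) (fun u => D.flow_mem hσ _)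
    ((D.isSolution σ hσ).comp_add_const s) t
  simpa using h

/-- `D` **preserves** `μ`: the carrier has full measure and every `Φ_t` is measure preserving
(Mathlib `MeasurePreserving`, measurability included). For a Gibbs state this is the invariance
asserted (for the severed flows) in LLL 1977, §4 remark (i); defined here for use as a claim. [folklore] -/
def PreservesMeasure (μ : Measure ChainConfig) : Prop :=
  (∀ᵐ σ ∂μ, σ ∈ D.carrier) ∧ ∀ t : ℝ, MeasurePreserving (D.flow t) μ μ

/-- Under an invariant measure, `∫ G ∘ Φ_t dμ = ∫ G dμ`. [folklore] -/
theorem PreservesMeasure.integral_comp_flow {D : P.Dynamics} {μ : Measure ChainConfig}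
    (h : D.PreservesMeasure μ) {G : ChainConfig → ℝ} (hG : AEStronglyMeasurable G μ) (t : ℝ) :
    ∫ σ, G (D.flow t σ) ∂μ = ∫ σ, G σ ∂μ := by
  have hmp := h.2 t
  have hG' : AEStronglyMeasurable G (Measure.map (D.flow t) μ) := by rwa [hmp.map_eq]
  rw [← integral_map hmp.aemeasurable hG', hmp.map_eq]

end Dynamics

end InfiniteChain

/-! ## Bridge: the homogeneous chain is the constant-profile instance -/

namespace OscillatorChain

variable (P : OscillatorChain)

/-- The homogeneous chain `U_i = U`, `V_i = V` as a site-dependent chain. [folklore] -/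
def toInfiniteChain : InfiniteChain := ⟨fun _ => P.U, fun _ => P.V⟩

/-- The on-site potentials of the embedded chain are the constant family `U`. [folklore] -/
@[simp] theorem toInfiniteChain_U (i : ℤ) : P.toInfiniteChain.U i = P.U := rfl

/-- The bond potentials of the embedded chain are the constant family `V`. [folklore] -/
@[simp] theorem toInfiniteChain_V (i : ℤ) : P.toInfiniteChain.V i = P.V := rfl

/-- The interaction forces agree. [folklore] -/
@[simp] theorem interactionForce_toInfiniteChain :
    P.toInfiniteChain.interactionForce = P.interactionForce := rfl

/-- The forces agree. [folklore] -/
@[simp] theorem force_toInfiniteChain : P.toInfiniteChain.force = P.force := rfl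

/-- The local Lyapunov functions agree. [folklore] -/
@[simp] theorem siteEnergy_toInfiniteChain : P.toInfiniteChain.siteEnergy = P.siteEnergy := rfl

/-- Solutions agree. [folklore] -/
@[simp] theorem isSolution_toInfiniteChain : P.toInfiniteChain.IsSolution = P.IsSolution := rfl

/-- Solutions on a time set agree. [folklore] -/
@[simp] theorem isSolutionOn_toInfiniteChain : P.toInfiniteChain.IsSolutionOn = P.IsSolutionOn :=
  rfl

/-- Severed solutions agree. [folklore] -/
@[simp] theorem isSeveredSolution_toInfiniteChain :
    P.toInfiniteChain.IsSeveredSolution = P.IsSeveredSolution := rfl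

/-- The tempered classes agree. [folklore] -/
@[simp] theorem expTempered_toInfiniteChain : P.toInfiniteChain.expTempered = P.expTempered := rfl

/-- The interaction potentials agree. [folklore] -/
@[simp] theorem potential_toInfiniteChain : P.toInfiniteChain.potential = P.chainPotential := rfl

/-- The Gibbsian specifications agree. [folklore] -/
@[simp] theorem specification_toInfiniteChain :
    P.toInfiniteChain.specification = P.chainSpecification := rfl

/-- Gibbs states agree. [folklore] -/
theorem isGibbs_toInfiniteChain_iff (T : ℝ) (μ : Measure ChainConfig) :
    P.toInfiniteChain.IsGibbs T μ ↔ P.IsChainGibbsMeasure T μ := Iff.rfl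

/-- Conditions B1 agree. [folklore] -/
theorem condB1_toInfiniteChain_iff : P.toInfiniteChain.CondB1 ↔ P.CondB1 := Iff.rfl

/-- Conditions B2 agree. [folklore] -/
theorem condB2_toInfiniteChain_iff (T : ℝ) : P.toInfiniteChain.CondB2 T ↔ P.CondB2 T := Iff.rfl

end OscillatorChain

/-- A homogeneous infinite-volume dynamics is the same thing as a dynamics of the constant-profile
chain (all fields agree definitionally). [folklore] -/
def InfiniteChainDynamics.equivDynamics (P : OscillatorChain) :
    InfiniteChainDynamics P ≃ P.toInfiniteChain.Dynamics where
  toFun D := ⟨D.carrier, D.flow, D.mapsTo, D.flow_zero, D.isSolution, D.unique⟩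
  invFun D := ⟨D.carrier, D.flow, D.mapsTo, D.flow_zero, D.isSolution, D.unique⟩
  left_inv _ := rfl
  right_inv _ := rfl

/-- The equivalence does not change the flow. [folklore] -/
@[simp] theorem InfiniteChainDynamics.equivDynamics_flow (P : OscillatorChain)
    (D : InfiniteChainDynamics P) : (InfiniteChainDynamics.equivDynamics P D).flow = D.flow := rfl

/-- The equivalence does not change the carrier. [folklore] -/
@[simp] theorem InfiniteChainDynamics.equivDynamics_carrier (P : OscillatorChain)
    (D : InfiniteChainDynamics P) :
    (InfiniteChainDynamics.equivDynamics P D).carrier = D.carrier := rfl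

/-- Invariant measures agree along the equivalence. [folklore] -/
theorem InfiniteChainDynamics.preservesMeasure_equivDynamics_iff (P : OscillatorChain)
    (D : InfiniteChainDynamics P) (μ : Measure ChainConfig) :
    (InfiniteChainDynamics.equivDynamics P D).PreservesMeasure μ ↔ D.PreservesMeasure μ := Iff.rfl

/-! ## Quartic profiles and the harmonic host with cells -/

/-- The chain with harmonic pinning `ω₂`, unit harmonic bonds and **site-dependent quartic
couplings**: `U_i(q) = ω₂ q²/2 + lam_i q⁴/4`, `V_i(r) = r²/2 + β_i r⁴/4`, profiles
`lam, β : ℤ → ℝ` (Bonetto–Lebowitz–Rey-Bellet 2000, §3 eq. (8): crystal Hamiltonian with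
site-dependent pinning `U_i`; the quartic terms are those of §10 item 1; letting the bond coupling
`β_i` depend on the bond as well is the obvious extension used by the dilute / one-cell chains). [cite: BonettoLebowitzReyBellet2000, §3 eq. (8) and §10 item 1] -/
def quarticChain (ω₂ : ℝ) (lam β : ℤ → ℝ) : InfiniteChain where
  U i q := ω₂ * q ^ 2 / 2 + lam i * q ^ 4 / 4
  V i r := r ^ 2 / 2 + β i * r ^ 4 / 4

/-- The coupling profile of cells of strength `c` at the sites of `S`: `c·1_S`. [folklore] -/
def cellProfile (S : Finset ℤ) (c : ℝ) : ℤ → ℝ := fun i => if i ∈ S then c else 0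

/-- The **pinned harmonic host carrying conjunct cells at the sites of `S`**: pinning `ω₂ q²/2`
and unit harmonic bonds everywhere; at each `x ∈ S` the on-site term `lam q_x⁴/4` and on the bond
`(x, x+1)` the FPU-`β` term `β (q_{x+1} - q_x)⁴/4`. `S = {0}`: one cell at the origin;
`S = {0, d}`: two cells at distance `d`; `S = ∅`: the pure harmonic host. [folklore] -/
def harmonicHostWithCell (ω₂ lam β : ℝ) (S : Finset ℤ) : InfiniteChain :=
  quarticChain ω₂ (cellProfile S lam) (cellProfile S β)

section Quartic

variable (ω₂ : ℝ) (lam β : ℤ → ℝ)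

/-- Unfolding the on-site potential of the quartic profile chain. [folklore] -/
@[simp] theorem quarticChain_U (i : ℤ) (q : ℝ) :
    (quarticChain ω₂ lam β).U i q = ω₂ * q ^ 2 / 2 + lam i * q ^ 4 / 4 := rfl

/-- Unfolding the bond potential of the quartic profile chain. [folklore] -/
@[simp] theorem quarticChain_V (i : ℤ) (r : ℝ) :
    (quarticChain ω₂ lam β).V i r = r ^ 2 / 2 + β i * r ^ 4 / 4 := rfl

/-- At a cell site the profile takes the value `c`. [folklore] -/
@[simp] theorem cellProfile_of_mem {S : Finset ℤ} (c : ℝ) {i : ℤ} (h : i ∈ S) :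
    cellProfile S c i = c := by simp [cellProfile, h]

/-- Off the cells the profile vanishes. [folklore] -/
@[simp] theorem cellProfile_of_not_mem {S : Finset ℤ} (c : ℝ) {i : ℤ} (h : i ∉ S) :
    cellProfile S c i = 0 := by simp [cellProfile, h]

/-- Without cells the profile is identically zero. [folklore] -/
@[simp] theorem cellProfile_empty (c : ℝ) : cellProfile ∅ c = fun _ => 0 := by
  funext i; simp [cellProfile]

/-- The homogeneous conjunct chain `pinnedChain ω₂ lam β γ` is the constant-profile instance (the
bath constant `γ` plays no role on `ℤ`). [folklore] -/
theorem OscillatorChain.toInfiniteChain_pinnedChain (ω₂ lam β γ : ℝ) :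
    (pinnedChain ω₂ lam β γ).toInfiniteChain = quarticChain ω₂ (fun _ => lam) (fun _ => β) := rfl

/-- Without cells the host is the harmonic `pinnedChain ω₂ 0 0 γ` on `ℤ`. [folklore] -/
theorem harmonicHostWithCell_empty (ω₂ lam β γ : ℝ) :
    harmonicHostWithCell ω₂ lam β ∅ = (pinnedChain ω₂ 0 0 γ).toInfiniteChain := by
  simp [harmonicHostWithCell, OscillatorChain.toInfiniteChain_pinnedChain]

/-- At a cell site the on-site potential is the conjunct's `ω₂ q²/2 + lam q⁴/4`. [folklore] -/
theorem harmonicHostWithCell_U_of_mem {ω₂ lam β : ℝ} {S : Finset ℤ} {x : ℤ} (hx : x ∈ S) (q : ℝ) :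
    (harmonicHostWithCell ω₂ lam β S).U x q = ω₂ * q ^ 2 / 2 + lam * q ^ 4 / 4 := by
  simp [harmonicHostWithCell, hx]

/-- At a cell site the bond `(x, x+1)` carries the FPU-`β` term. [folklore] -/
theorem harmonicHostWithCell_V_of_mem {ω₂ lam β : ℝ} {S : Finset ℤ} {x : ℤ} (hx : x ∈ S) (r : ℝ) :
    (harmonicHostWithCell ω₂ lam β S).V x r = r ^ 2 / 2 + β * r ^ 4 / 4 := by
  simp [harmonicHostWithCell, hx]

/-- Off the cells the pinning is harmonic, `ω₂ q²/2`. [folklore] -/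
theorem harmonicHostWithCell_U_of_not_mem {ω₂ lam β : ℝ} {S : Finset ℤ} {x : ℤ} (hx : x ∉ S)
    (q : ℝ) : (harmonicHostWithCell ω₂ lam β S).U x q = ω₂ * q ^ 2 / 2 := by
  simp [harmonicHostWithCell, hx]

/-- Off the cells the bonds are unit harmonic. [folklore] -/
theorem harmonicHostWithCell_V_of_not_mem {ω₂ lam β : ℝ} {S : Finset ℤ} {x : ℤ} (hx : x ∉ S)
    (r : ℝ) : (harmonicHostWithCell ω₂ lam β S).V x r = r ^ 2 / 2 := by
  simp [harmonicHostWithCell, hx]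

/-- Derivative of the quadratic-plus-quartic potential `a s²/2 + c s⁴/4`. [folklore] -/
theorem hasDerivAt_quadQuartic (a c s : ℝ) :
    HasDerivAt (fun s => a * s ^ 2 / 2 + c * s ^ 4 / 4) (a * s + c * s ^ 3) s := by
  have h2 : HasDerivAt (fun s : ℝ => s ^ 2) (2 * s) s := by simpa using hasDerivAt_pow 2 s
  have h4 : HasDerivAt (fun s : ℝ => s ^ 4) (4 * s ^ 3) s := by simpa using hasDerivAt_pow 4 s
  have h := ((h2.const_mul a).div_const 2).add ((h4.const_mul c).div_const 4)
  refine h.congr_deriv ?_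
  ring

/-- `d/ds (a s²/2 + c s⁴/4) = a s + c s³`. [folklore] -/
theorem deriv_quadQuartic (a c s : ℝ) :
    deriv (fun s => a * s ^ 2 / 2 + c * s ^ 4 / 4) s = a * s + c * s ^ 3 :=
  (hasDerivAt_quadQuartic a c s).deriv

/-- `U_i' (q) = ω₂ q + lam_i q³`. [folklore] -/
@[simp] theorem deriv_quarticChain_U (i : ℤ) (q : ℝ) :
    deriv ((quarticChain ω₂ lam β).U i) q = ω₂ * q + lam i * q ^ 3 :=
  deriv_quadQuartic ω₂ (lam i) q

/-- `V_i' (r) = r + β_i r³`. [folklore] -/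
@[simp] theorem deriv_quarticChain_V (i : ℤ) (r : ℝ) :
    deriv ((quarticChain ω₂ lam β).V i) r = r + β i * r ^ 3 := by
  have := deriv_quadQuartic 1 (β i) r
  simp only [one_mul] at this
  exact this

/-- **The equations of motion of the quartic profile chain**:
`F_i = -(ω₂ q_i + lam_i q_i³) + (r_i + β_i r_i³) - (r_{i-1} + β_{i-1} r_{i-1}³)`,
`r_i = q_{i+1} - q_i`. [folklore] -/
theorem quarticChain_force (σ : ChainConfig) (i : ℤ) :
    (quarticChain ω₂ lam β).force σ i =
      -(ω₂ * (σ i).1 + lam i * (σ i).1 ^ 3) +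
        (((σ (i + 1)).1 - (σ i).1) + β i * ((σ (i + 1)).1 - (σ i).1) ^ 3) -
        (((σ i).1 - (σ (i - 1)).1) + β (i - 1) * ((σ i).1 - (σ (i - 1)).1) ^ 3) := by
  rw [InfiniteChain.force_eq, deriv_quarticChain_U, deriv_quarticChain_V, deriv_quarticChain_V]

/-- **The one-cell chain's equation of motion at the cell** (`S = {0}`):
`ṗ_0 = -(ω₂ q_0 + lam q_0³) + (q_1 - q_0) + β (q_1 - q_0)³ - (q_0 - q_{-1})`. [folklore] -/
theorem harmonicHostWithCell_singleton_force_zero (ω₂ lam β : ℝ) (σ : ChainConfig) :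
    (harmonicHostWithCell ω₂ lam β {0}).force σ 0 =
      -(ω₂ * (σ 0).1 + lam * (σ 0).1 ^ 3) +
        (((σ 1).1 - (σ 0).1) + β * ((σ 1).1 - (σ 0).1) ^ 3) - ((σ 0).1 - (σ (-1)).1) := by
  rw [harmonicHostWithCell, quarticChain_force]
  simp

/-- In the one-cell chain the right partner of the cell bond feels the FPU-`β` force too:
`ṗ_1 = -ω₂ q_1 + (q_2 - q_1) - (q_1 - q_0) - β (q_1 - q_0)³` (so for `β ≠ 0` the anharmonic
unit is the pair of sites `{0, 1}`). [folklore] -/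
theorem harmonicHostWithCell_singleton_force_one (ω₂ lam β : ℝ) (σ : ChainConfig) :
    (harmonicHostWithCell ω₂ lam β {0}).force σ 1 =
      -(ω₂ * (σ 1).1) + ((σ 2).1 - (σ 1).1) -
        (((σ 1).1 - (σ 0).1) + β * ((σ 1).1 - (σ 0).1) ^ 3) := by
  rw [harmonicHostWithCell, quarticChain_force]
  simp

/-- Away from the cells and their right partners the motion is that of the pinned harmonic
host: `ṗ_x = -ω₂ q_x + q_{x+1} + q_{x-1} - 2 q_x`. [folklore] -/
theorem harmonicHostWithCell_force_of_not_mem {ω₂ lam β : ℝ} {S : Finset ℤ} {x : ℤ}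
    (hx : x ∉ S) (hx' : x - 1 ∉ S) (σ : ChainConfig) :
    (harmonicHostWithCell ω₂ lam β S).force σ x =
      -(ω₂ * (σ x).1) + ((σ (x + 1)).1 - (σ x).1) - ((σ x).1 - (σ (x - 1)).1) := by
  rw [harmonicHostWithCell, quarticChain_force]
  simp [hx, hx']

/-- The potentials of the quartic profile chain are smooth (LLL's A2 with room to spare). [folklore] -/
theorem contDiff_quarticChain_U (i : ℤ) {n : WithTop ℕ∞} :
    ContDiff ℝ n ((quarticChain ω₂ lam β).U i) := by
  change ContDiff ℝ n fun q => ω₂ * q ^ 2 / 2 + lam i * q ^ 4 / 4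
  fun_prop

/-- The bond potentials of the quartic profile chain are smooth. [folklore] -/
theorem contDiff_quarticChain_V (i : ℤ) {n : WithTop ℕ∞} :
    ContDiff ℝ n ((quarticChain ω₂ lam β).V i) := by
  change ContDiff ℝ n fun r => r ^ 2 / 2 + β i * r ^ 4 / 4
  fun_prop

/-- For nonnegative pinning and couplings the potentials are nonnegative (bounded below, the
hypothesis of the B1 criterion `condB1_of_bddBelow` in the homogeneous case). [folklore] -/
theorem quarticChain_U_nonneg {ω₂ : ℝ} {lam β : ℤ → ℝ} (hω : 0 ≤ ω₂) (hlam : ∀ i, 0 ≤ lam i)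
    (i : ℤ) (q : ℝ) : 0 ≤ (quarticChain ω₂ lam β).U i q := by
  simp only [quarticChain_U]
  have := hlam i
  positivity

/-- For nonnegative couplings the bond potentials are nonnegative. [folklore] -/
theorem quarticChain_V_nonneg {ω₂ : ℝ} {lam β : ℤ → ℝ} (hβ : ∀ i, 0 ≤ β i) (i : ℤ) (r : ℝ) :
    0 ≤ (quarticChain ω₂ lam β).V i r := by
  simp only [quarticChain_V]
  have := hβ i
  positivity

/-- The zero configuration is an equilibrium of every quartic profile chain. [folklore] -/
theorem isSolution_zero_quarticChain :
    (quarticChain ω₂ lam β).IsSolution fun _ _ => ((0 : ℝ), (0 : ℝ)) :=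
  InfiniteChain.isSolution_const (fun _ => rfl) fun i => by simp [quarticChain_force]

end Quartic

/-! ### The host's phonon band and plane waves (non-vacuity of `IsSolution`) -/

/-- The dispersion relation of the pinned harmonic host: `ω(k) = √(ω₂ + 2 - 2 cos k)`
(`= √(ω₂ + 4 sin²(k/2))`). [folklore] -/
def hostDispersion (ω₂ k : ℝ) : ℝ := Real.sqrt (ω₂ + 2 - 2 * Real.cos k)

/-- `ω(k)² = ω₂ + 2 - 2 cos k` for `ω₂ ≥ 0`. [folklore] -/
theorem hostDispersion_sq {ω₂ : ℝ} (hω : 0 ≤ ω₂) (k : ℝ) :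
    hostDispersion ω₂ k ^ 2 = ω₂ + 2 - 2 * Real.cos k := by
  rw [hostDispersion, Real.sq_sqrt]
  linarith [Real.cos_le_one k]

/-- Half-angle form of the dispersion relation: `ω(k)² = ω₂ + 4 sin²(k/2)`. [folklore] -/
theorem hostDispersion_sq_eq_sin {ω₂ : ℝ} (hω : 0 ≤ ω₂) (k : ℝ) :
    hostDispersion ω₂ k ^ 2 = ω₂ + 4 * Real.sin (k / 2) ^ 2 := by
  rw [hostDispersion_sq hω]
  have h := Real.cos_sq (k / 2)
  have h2k : 2 * (k / 2) = k := by ring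
  rw [h2k] at h
  have h2 : Real.sin (k / 2) ^ 2 = 1 - Real.cos (k / 2) ^ 2 := by
    rw [Real.sin_sq]
  rw [h2, h]; ring

/-- Lower band edge: `√ω₂ ≤ ω(k)`, attained at `k = 0`. [folklore] -/
theorem sqrt_le_hostDispersion (ω₂ k : ℝ) : Real.sqrt ω₂ ≤ hostDispersion ω₂ k :=
  Real.sqrt_le_sqrt (by linarith [Real.cos_le_one k])

/-- Upper band edge: `ω(k) ≤ √(ω₂ + 4)`, attained at `k = π`. [folklore] -/
theorem hostDispersion_le_sqrt (ω₂ k : ℝ) : hostDispersion ω₂ k ≤ Real.sqrt (ω₂ + 4) :=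
  Real.sqrt_le_sqrt (by linarith [Real.neg_one_le_cos k])

/-- The lower band edge is attained at `k = 0`. [folklore] -/
@[simp] theorem hostDispersion_zero (ω₂ : ℝ) : hostDispersion ω₂ 0 = Real.sqrt ω₂ := by
  simp [hostDispersion]

/-- The upper band edge is attained at `k = π`. [folklore] -/
@[simp] theorem hostDispersion_pi (ω₂ : ℝ) : hostDispersion ω₂ Real.pi = Real.sqrt (ω₂ + 4) := by
  rw [hostDispersion, Real.cos_pi]; congr 1; ring

/-- The plane wave `q_i(t) = A cos(k i - w t + φ)`, `p_i = q̇_i = A w sin(k i - w t + φ)` of wave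
number `k` and frequency `w`. [folklore] -/
def planeWave (A k w φ : ℝ) : ℝ → ChainConfig := fun t i =>
  (A * Real.cos (k * i - w * t + φ), A * w * Real.sin (k * i - w * t + φ))

/-- **Plane waves solve the pure harmonic host** (`lam = β = 0`) exactly when they lie on the
phonon band, `w² = ω₂ + 2 - 2 cos k` (i.e. `w = ± hostDispersion ω₂ k`): `IsSolution` is
non-vacuous for the host. [folklore] -/
theorem isSolution_planeWave {ω₂ A k w φ : ℝ} (hw : w ^ 2 = ω₂ + 2 - 2 * Real.cos k) :
    (quarticChain ω₂ (fun _ => 0) (fun _ => 0)).IsSolution (planeWave A k w φ) := by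
  intro i t
  have hθ : HasDerivAt (fun s : ℝ => k * i - w * s + φ) (-w) t := by
    simpa using (((hasDerivAt_id t).const_mul w).const_sub (k * (i : ℝ))).add_const φ
  refine ⟨?_, ?_⟩
  · show HasDerivAt (fun s => A * Real.cos (k * i - w * s + φ))
      (A * w * Real.sin (k * i - w * t + φ)) t
    refine (((Real.hasDerivAt_cos _).comp t hθ).const_mul A).congr_deriv ?_
    ring
  · show HasDerivAt (fun s => A * w * Real.sin (k * i - w * s + φ))
      ((quarticChain ω₂ (fun _ => 0) (fun _ => 0)).force (planeWave A k w φ t) i) t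
    refine (((Real.hasDerivAt_sin _).comp t hθ).const_mul (A * w)).congr_deriv ?_
    rw [quarticChain_force]
    simp only [planeWave, zero_mul, add_zero, Int.cast_add, Int.cast_one, Int.cast_sub]
    have e1 : k * ((i : ℝ) + 1) - w * t + φ = (k * i - w * t + φ) + k := by ring
    have e2 : k * ((i : ℝ) - 1) - w * t + φ = (k * i - w * t + φ) - k := by ring
    rw [e1, e2, Real.cos_add (k * i - w * t + φ) k, Real.cos_sub (k * i - w * t + φ) k]
    have hw' : w * w = ω₂ + 2 - 2 * Real.cos k := by rw [← hw]; ring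
    linear_combination (-A * Real.cos (k * i - w * t + φ)) * hw'

/-! ## Local observables and time-correlation functions -/

/-- `F` is a **smooth local observable of polynomial growth in the window `Λ`**: `F(σ) = f(σ|_Λ)`
for some `f ∈ C^∞((ℝ × ℝ)^Λ)` with `|f(x)| ≤ C (1 + ‖x‖)^k` (the class of test observables in the
requesting statement: "smooth local `F, G` of polynomial growth"). [folklore] -/
def IsSmoothLocalObservable (Λ : Finset ℤ) (F : ChainConfig → ℝ) : Prop :=
  ∃ f : (Λ → ℝ × ℝ) → ℝ, ContDiff ℝ ∞ f ∧
    (∃ C : ℝ, 0 ≤ C ∧ ∃ k : ℕ, ∀ x, |f x| ≤ C * (1 + ‖x‖) ^ k) ∧ ∀ σ, F σ = f fun i => σ i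

namespace IsSmoothLocalObservable

variable {Λ : Finset ℤ} {F G : ChainConfig → ℝ}

/-- A smooth local observable is measurable (product σ-algebra). [folklore] -/
theorem measurable (hF : IsSmoothLocalObservable Λ F) : Measurable F := by
  obtain ⟨f, hf, -, hF⟩ := hF
  have : F = f ∘ fun (σ : ChainConfig) (i : Λ) => σ i := funext hF
  rw [this]
  exact hf.continuous.measurable.comp (measurable_pi_lambda _ fun i => measurable_pi_apply _)

/-- A smooth local observable depends only on the coordinates in its window. [folklore] -/
theorem dependsOn (hF : IsSmoothLocalObservable Λ F) : DependsOn F (↑Λ : Set ℤ) := by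
  obtain ⟨f, -, -, hF⟩ := hF
  intro σ σ' h
  rw [hF, hF]
  congr 1
  funext i
  exact h i (Finset.mem_coe.2 i.2)

/-- Constants are smooth local observables. [folklore] -/
theorem const (Λ : Finset ℤ) (c : ℝ) : IsSmoothLocalObservable Λ fun _ => c :=
  ⟨fun _ => c, contDiff_const, ⟨|c|, abs_nonneg c, 0, fun x => by simp⟩, fun _ => rfl⟩

/-- The position `q_i` of a site of the window is a smooth local observable. [folklore] -/
theorem fst {Λ : Finset ℤ} {i : ℤ} (hi : i ∈ Λ) : IsSmoothLocalObservable Λ fun σ => (σ i).1 := by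
  refine ⟨fun x => (x ⟨i, hi⟩).1, by fun_prop, ⟨1, zero_le_one, 1, fun x => ?_⟩, fun _ => rfl⟩
  calc |(x ⟨i, hi⟩).1| = ‖(x ⟨i, hi⟩).1‖ := (Real.norm_eq_abs _).symm
    _ ≤ ‖x ⟨i, hi⟩‖ := norm_fst_le _
    _ ≤ ‖x‖ := norm_le_pi_norm x _
    _ ≤ 1 * (1 + ‖x‖) ^ 1 := by simp

/-- The momentum `p_i` of a site of the window is a smooth local observable. [folklore] -/
theorem snd {Λ : Finset ℤ} {i : ℤ} (hi : i ∈ Λ) : IsSmoothLocalObservable Λ fun σ => (σ i).2 := by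
  refine ⟨fun x => (x ⟨i, hi⟩).2, by fun_prop, ⟨1, zero_le_one, 1, fun x => ?_⟩, fun _ => rfl⟩
  calc |(x ⟨i, hi⟩).2| = ‖(x ⟨i, hi⟩).2‖ := (Real.norm_eq_abs _).symm
    _ ≤ ‖x ⟨i, hi⟩‖ := norm_snd_le _
    _ ≤ ‖x‖ := norm_le_pi_norm x _
    _ ≤ 1 * (1 + ‖x‖) ^ 1 := by simp

/-- Sums of smooth local observables are smooth local observables. [folklore] -/
theorem add (hF : IsSmoothLocalObservable Λ F) (hG : IsSmoothLocalObservable Λ G) :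
    IsSmoothLocalObservable Λ fun σ => F σ + G σ := by
  obtain ⟨f, hf, ⟨C, hC, k, hfb⟩, hF⟩ := hF
  obtain ⟨g, hg, ⟨C', hC', k', hgb⟩, hG⟩ := hG
  refine ⟨fun x => f x + g x, hf.add hg, ⟨C + C', by positivity, k + k', fun x => ?_⟩,
    fun σ => by simp only [hF, hG]⟩
  have h1 : (1 : ℝ) ≤ 1 + ‖x‖ := by simp
  have hk : (1 + ‖x‖) ^ k ≤ (1 + ‖x‖) ^ (k + k') := pow_le_pow_right₀ h1 (by omega)
  have hk' : (1 + ‖x‖) ^ k' ≤ (1 + ‖x‖) ^ (k + k') := pow_le_pow_right₀ h1 (by omega)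
  calc |f x + g x| ≤ |f x| + |g x| := abs_add_le _ _
    _ ≤ C * (1 + ‖x‖) ^ k + C' * (1 + ‖x‖) ^ k' := add_le_add (hfb x) (hgb x)
    _ ≤ C * (1 + ‖x‖) ^ (k + k') + C' * (1 + ‖x‖) ^ (k + k') :=
        add_le_add (mul_le_mul_of_nonneg_left hk hC) (mul_le_mul_of_nonneg_left hk' hC')
    _ = (C + C') * (1 + ‖x‖) ^ (k + k') := by ring

/-- Products of smooth local observables are smooth local observables. [folklore] -/
theorem mul (hF : IsSmoothLocalObservable Λ F) (hG : IsSmoothLocalObservable Λ G) :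
    IsSmoothLocalObservable Λ fun σ => F σ * G σ := by
  obtain ⟨f, hf, ⟨C, hC, k, hfb⟩, hF⟩ := hF
  obtain ⟨g, hg, ⟨C', hC', k', hgb⟩, hG⟩ := hG
  refine ⟨fun x => f x * g x, hf.mul hg, ⟨C * C', by positivity, k + k', fun x => ?_⟩,
    fun σ => by simp only [hF, hG]⟩
  calc |f x * g x| = |f x| * |g x| := abs_mul _ _
    _ ≤ C * (1 + ‖x‖) ^ k * (C' * (1 + ‖x‖) ^ k') :=
        mul_le_mul (hfb x) (hgb x) (abs_nonneg _) (le_trans (abs_nonneg _) (hfb x))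
    _ = C * C' * (1 + ‖x‖) ^ (k + k') := by ring

/-- Scalar multiples of smooth local observables are smooth local observables. [folklore] -/
theorem const_mul (hF : IsSmoothLocalObservable Λ F) (c : ℝ) :
    IsSmoothLocalObservable Λ fun σ => c * F σ :=
  (const Λ c).mul hF

/-- Enlarging the window keeps an observable smooth local (restriction of coordinates). [folklore] -/
theorem mono {Λ' : Finset ℤ} (hΛ : Λ ⊆ Λ') (hF : IsSmoothLocalObservable Λ F) :
    IsSmoothLocalObservable Λ' F := by
  obtain ⟨f, hf, ⟨C, hC, k, hfb⟩, hF⟩ := hF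
  refine ⟨fun x => f fun i => x ⟨i, hΛ i.2⟩, ?_, ⟨C, hC, k, fun x => ?_⟩, fun σ => by rw [hF]⟩
  · exact hf.comp (contDiff_pi.2 fun i => by fun_prop)
  · refine (hfb _).trans ?_
    have hρ : ‖(fun i : Λ => x ⟨i, hΛ i.2⟩)‖ ≤ ‖x‖ :=
      (pi_norm_le_iff_of_nonneg (norm_nonneg x)).2 fun i => norm_le_pi_norm x _
    have h0 : 0 ≤ 1 + ‖(fun i : Λ => x ⟨i, hΛ i.2⟩)‖ := by positivity
    exact mul_le_mul_of_nonneg_left (pow_le_pow_left₀ h0 (by linarith) k) hC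

end IsSmoothLocalObservable

/-- The covariance (Mathlib `ProbabilityTheory.covariance`) only depends on the a.e. class of
its second argument (one-sided special case of
`Literature.MathematicalPhysics.KineticTheory.covariance_congr_ae` of `FluctuationSpace.lean`,
restated here to avoid that file's hard-sphere imports). [folklore] -/
theorem covariance_congr_ae_right {Ω : Type*} [MeasurableSpace Ω] {μ : Measure Ω}
    {X Y Y' : Ω → ℝ} (h : Y =ᵐ[μ] Y') : cov[X, Y; μ] = cov[X, Y'; μ] := by
  unfold covariance
  have h1 : ∫ a, Y a ∂μ = ∫ a, Y' a ∂μ := integral_congr_ae h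
  rw [h1]
  refine integral_congr_ae ?_
  filter_upwards [h] with x hx
  rw [hx]

namespace InfiniteChain.Dynamics

variable {P : InfiniteChain} (D : P.Dynamics)

/-- The **time-correlation function** `⟨F ; G ∘ Φ_t⟩_μ = ∫ (F - ⟨F⟩)(G ∘ Φ_t - ⟨G ∘ Φ_t⟩) dμ`
of two observables under the dynamics `D` in the state `μ` (truncated / connected correlation;
Mathlib `ProbabilityTheory.covariance`). [folklore] -/
def timeCorrelation (μ : Measure ChainConfig) (F G : ChainConfig → ℝ) (t : ℝ) : ℝ :=
  cov[F, G ∘ D.flow t; μ]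

/-- **Decay of correlations** in the window `Λ`: `⟨F ; G ∘ Φ_t⟩_μ → 0` as `t → ∞` for all smooth
local observables `F, G` of polynomial growth in `Λ`. [folklore] -/
def HasCorrelationDecay (μ : Measure ChainConfig) (Λ : Finset ℤ) : Prop :=
  ∀ F G : ChainConfig → ℝ, IsSmoothLocalObservable Λ F → IsSmoothLocalObservable Λ G →
    Tendsto (D.timeCorrelation μ F G) atTop (𝓝 0)

/-- **Integrable decay of correlations** in the window `Λ`: `∫_0^∞ |⟨F ; G ∘ Φ_t⟩_μ| dt < ∞`
(Mathlib `IntegrableOn` on `(0, ∞)`, measurability in `t` included) for all smooth local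
observables `F, G` of polynomial growth in `Λ` — the quantitative mixing asked of the cell in
`stmt-AtomisticToContinuum-5550`. [folklore] -/
def HasIntegrableCorrelationDecay (μ : Measure ChainConfig) (Λ : Finset ℤ) : Prop :=
  ∀ F G : ChainConfig → ℝ, IsSmoothLocalObservable Λ F → IsSmoothLocalObservable Λ G →
    IntegrableOn (D.timeCorrelation μ F G) (Ioi 0)

variable {D}

/-- Unfolding `timeCorrelation`. [folklore] -/
theorem timeCorrelation_eq (μ : Measure ChainConfig) (F G : ChainConfig → ℝ) (t : ℝ) :
    D.timeCorrelation μ F G t = cov[F, G ∘ D.flow t; μ] := rfl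

/-- At `t = 0` the time correlation is the static covariance, provided the carrier has full
measure. [folklore] -/
theorem timeCorrelation_zero {μ : Measure ChainConfig} (h : ∀ᵐ σ ∂μ, σ ∈ D.carrier)
    (F G : ChainConfig → ℝ) : D.timeCorrelation μ F G 0 = cov[F, G; μ] := by
  have hae : (G ∘ D.flow 0) =ᵐ[μ] G := h.mono fun σ hσ => by simp [D.flow_zero σ hσ]
  exact covariance_congr_ae_right hae

/-- Under an invariant probability measure and for square-integrable observables,
`⟨F ; G ∘ Φ_t⟩ = ∫ F · (G ∘ Φ_t) dμ - (∫ F dμ)(∫ G dμ)`. [folklore] -/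
theorem timeCorrelation_eq_integral_mul_sub {μ : Measure ChainConfig} [IsProbabilityMeasure μ]
    (h : D.PreservesMeasure μ) {F G : ChainConfig → ℝ} (hF : MemLp F 2 μ) (hG : MemLp G 2 μ)
    (t : ℝ) :
    D.timeCorrelation μ F G t =
      ∫ σ, F σ * G (D.flow t σ) ∂μ - (∫ σ, F σ ∂μ) * ∫ σ, G σ ∂μ := by
  have hGt : MemLp (G ∘ D.flow t) 2 μ := hG.comp_measurePreserving (h.2 t)
  have h1 : ∫ σ, G (D.flow t σ) ∂μ = ∫ σ, G σ ∂μ := h.integral_comp_flow hG.aestronglyMeasurable t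
  rw [timeCorrelation, covariance_eq_sub hF hGt]
  simp only [Pi.mul_apply, Function.comp_apply, h1]

/-- Correlation decay on a window implies it on every smaller window. [folklore] -/
theorem HasCorrelationDecay.anti {μ : Measure ChainConfig} {Λ Λ' : Finset ℤ}
    (h : D.HasCorrelationDecay μ Λ') (hΛ : Λ ⊆ Λ') : D.HasCorrelationDecay μ Λ :=
  fun F G hF hG => h F G (hF.mono hΛ) (hG.mono hΛ)

/-- Integrable correlation decay on a window implies it on every smaller window. [folklore] -/
theorem HasIntegrableCorrelationDecay.anti {μ : Measure ChainConfig} {Λ Λ' : Finset ℤ}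
    (h : D.HasIntegrableCorrelationDecay μ Λ') (hΛ : Λ ⊆ Λ') :
    D.HasIntegrableCorrelationDecay μ Λ :=
  fun F G hF hG => h F G (hF.mono hΛ) (hG.mono hΛ)

end InfiniteChain.Dynamics

end Literature.MathematicalPhysics.KineticTheory.HeatConduction

end
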